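import Mathlib
import Literature.MathematicalPhysics.QuantumLattice.WilsonDiracAP
import HarnessLib

/-!
# Route QuarksAsStableAction — posited objects: the bond-diluted Wilson–Dirac operator

Objects posited by the proof line `Sketch` of the crux `UnquenchedChessboardBound`
(stmt-QuantumFields-9735): the floor on the signed partition function is obtained by
reflection-positivity PEELING, which compares the Wilson fermion determinant with the determinants
of operators whose hopping terms are kept only on a set `E` of lattice bonds (slabs, single time
slices, the two reflection planes). This file defines that operator and proves its structural
properties; nothing here is specific to the crux.

* `bondWilsonDirac ρ E U m r` — the gauge-covariant Wilson–Dirac matrix of the four-torus with the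
  forward and backward hopping terms of the bond `(x, μ)` (from `x` to `x + μ̂`) present iff
  `(x, μ) ∈ E`; the mass/Wilson diagonal `m + 4r` is kept at every site (Montvay–Münster (4.85),
  (5.5) with a bond cut-off). `bondWilsonDirac_univ`: `E = univ` is the tree's `wilsonDirac`.
* `bondWilsonDirac_gammaFive_hermitian`, `det_bondWilsonDirac_im`: `γ₅ D_E γ₅ = D_Eᴴ` and
  `Im det D_E = 0` for unitary `ρ` (the tree's argument for `wilsonDirac`, Montvay–Münster (5.15),
  (5.16), is local bond by bond).
* `bondWilsonDiracAP E U m` — the same for the crux's antiperiodic `SU(N)` quarks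
  (`apLift U`, `r = 1`); `bondWilsonDiracAP_univ : bondWilsonDiracAP univ U m = wilsonDiracAP U m`.

References: I. Montvay, G. Münster, *Quantum Fields on a Lattice* (1994) §4.2.2 (4.85), §5.1.1
(5.5), §5.1.2 (5.15)–(5.16). All statements here are proved.
-/

noncomputable section

open Matrix Complex Finset
open Literature.MathematicalPhysics.QuantumFieldTheory Literature.MathematicalPhysics.QuantumLattice
open Literature.Probability.LatticeModels
open scoped ComplexConjugate BigOperators

namespace Summit.QuantumFields.QCD.Theorems.QuarksAsStableAction

section General

variable {L N : ℕ} {G : Type*} [Group G] (ρ : G →* Matrix (Fin N) (Fin N) ℂ)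

/-- **The bond-diluted Wilson–Dirac operator** on the four-torus: the tree's `wilsonDirac ρ U m r`
with the forward hop `ψ̄_x (r - γ_μ) ρ(U(x,μ)) ψ_{x+μ̂}` and the backward hop
`ψ̄_{x+μ̂} (r + γ_μ) ρ(U(x,μ))⁻¹ ψ_x` of the bond `(x, μ)` kept iff `(x, μ) ∈ E`, and the diagonal
`m + 4r` kept everywhere (Montvay–Münster (4.85), (5.5) restricted to a bond set). -/
def bondWilsonDirac (E : Finset (Edge 4 L)) (U : GaugeConfig 4 L G) (m r : ℝ) :
    Matrix (TorusSite 4 L × Fin N × Fin 4) (TorusSite 4 L × Fin N × Fin 4) ℂ :=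
  Matrix.of fun p q =>
    (if p = q then ((m + 4 * r : ℝ) : ℂ) else 0) -
      (1 / 2 : ℂ) * ∑ μ : Fin 4,
        ((if q.1 = Site.shift p.1 μ ∧ (p.1, μ) ∈ E then
            ((r : ℂ) • (1 : Matrix (Fin 4) (Fin 4) ℂ) - euclideanGamma μ) p.2.2 q.2.2 *
              ρ (U (p.1, μ)) p.2.1 q.2.1 else 0) +
          (if p.1 = Site.shift q.1 μ ∧ (q.1, μ) ∈ E then
            ((r : ℂ) • (1 : Matrix (Fin 4) (Fin 4) ℂ) + euclideanGamma μ) p.2.2 q.2.2 *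
              ρ (U (q.1, μ))⁻¹ p.2.1 q.2.1 else 0))

/-- With every bond present the diluted operator is the Wilson–Dirac operator. -/
theorem bondWilsonDirac_univ [NeZero L] (U : GaugeConfig 4 L G) (m r : ℝ) :
    bondWilsonDirac ρ univ U m r = wilsonDirac ρ U m r := by
  ext p q
  simp only [bondWilsonDirac, wilsonDirac, Matrix.of_apply, Finset.mem_univ, and_true]

/-- The entry formula. -/
theorem bondWilsonDirac_apply (E : Finset (Edge 4 L)) (U : GaugeConfig 4 L G) (m r : ℝ)
    (p q : TorusSite 4 L × Fin N × Fin 4) :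
    bondWilsonDirac ρ E U m r p q =
      (if p = q then ((m + 4 * r : ℝ) : ℂ) else 0) -
        (1 / 2 : ℂ) * ∑ μ : Fin 4,
          ((if q.1 = Site.shift p.1 μ ∧ (p.1, μ) ∈ E then
              ((r : ℂ) • (1 : Matrix (Fin 4) (Fin 4) ℂ) - euclideanGamma μ) p.2.2 q.2.2 *
                ρ (U (p.1, μ)) p.2.1 q.2.1 else 0) +
            (if p.1 = Site.shift q.1 μ ∧ (q.1, μ) ∈ E then
              ((r : ℂ) • (1 : Matrix (Fin 4) (Fin 4) ℂ) + euclideanGamma μ) p.2.2 q.2.2 *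
                ρ (U (q.1, μ))⁻¹ p.2.1 q.2.1 else 0)) := rfl

variable [NeZero L]

/-- **`γ₅`-hermiticity of the diluted operator**: `γ₅ D_E γ₅ = D_Eᴴ` for unitary `ρ` — the forward
hop of `D_{pq}` on a bond is matched with the backward hop of `D_{qp}` on the SAME bond, so the
tree's bondwise argument (Montvay–Münster (5.15)) applies verbatim. -/
-- adapted from Literature/MathematicalPhysics/QuantumLattice/GrassmannIntegralWilsonProofs.lean
theorem bondWilsonDirac_gammaFive_hermitian (hρ : ∀ g, ρ g ∈ Matrix.unitaryGroup (Fin N) ℂ)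
    (E : Finset (Edge 4 L)) (U : GaugeConfig 4 L G) (m r : ℝ) :
    spinorLift gammaFive * bondWilsonDirac ρ E U m r * spinorLift gammaFive =
      (bondWilsonDirac ρ E U m r)ᴴ := by
  rw [spinorLift_gammaFive_eq_diagonal]
  ext p q
  rw [mul_diagonal, diagonal_mul, conjTranspose_apply]
  simp only [bondWilsonDirac, of_apply]
  refine sign_conj_entry_aux _ _ _ _ _ _ _ _ _ ?_ (by simp) (fun μ => ?_) (fun μ => ?_)
  · by_cases h : p = q
    · subst h
      rw [if_pos rfl, mul_right_comm, gammaFiveSign_mul_self, one_mul]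
      exact (Complex.conj_ofReal _).symm
    · rw [if_neg h, if_neg (Ne.symm h), mul_zero, zero_mul, star_zero]
  · split_ifs with h
    · rw [star_mul', ← gammaFiveSign_mul_sub_euclideanGamma_mul_gammaFiveSign r μ p.2.2 q.2.2,
        unitaryRep_star_inv_apply ρ hρ]
      ring
    · rw [mul_zero, zero_mul, star_zero]
  · split_ifs with h
    · rw [star_mul', ← gammaFiveSign_mul_add_euclideanGamma_mul_gammaFiveSign r μ p.2.2 q.2.2,
        unitaryRep_star_apply ρ hρ]
      ring
    · rw [mul_zero, zero_mul, star_zero]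

/-- **The diluted Wilson determinant is real** for unitary `ρ` (`conj det D_E = det D_Eᴴ =
det (γ₅ D_E γ₅) = det D_E`, Montvay–Münster (5.16)). -/
theorem det_bondWilsonDirac_im (hρ : ∀ g, ρ g ∈ Matrix.unitaryGroup (Fin N) ℂ)
    (E : Finset (Edge 4 L)) (U : GaugeConfig 4 L G) (m r : ℝ) :
    ((bondWilsonDirac ρ E U m r).det).im = 0 := by
  have hΓ := bondWilsonDirac_gammaFive_hermitian ρ hρ E U m r
  have hdet : star (bondWilsonDirac ρ E U m r).det = (bondWilsonDirac ρ E U m r).det := by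
    rw [← det_conjTranspose, ← hΓ, det_mul, det_mul,
      mul_comm (det _) (det (bondWilsonDirac ρ E U m r)), mul_assoc, ← det_mul,
      spinorLift_gammaFive_mul_self, det_one, mul_one]
  exact Complex.conj_eq_iff_im.1 hdet

/-- The diluted determinant equals (the cast of) its real part. -/
theorem det_bondWilsonDirac_eq_ofReal_re (hρ : ∀ g, ρ g ∈ Matrix.unitaryGroup (Fin N) ℂ)
    (E : Finset (Edge 4 L)) (U : GaugeConfig 4 L G) (m r : ℝ) :
    (bondWilsonDirac ρ E U m r).det = ((((bondWilsonDirac ρ E U m r).det).re : ℝ) : ℂ) :=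
  Complex.ext (by simp) (by simpa using det_bondWilsonDirac_im ρ hρ E U m r)

end General

/-! ## The antiperiodic `SU(N)` version of the crux -/

section AP

variable {L N : ℕ}

/-- **The bond-diluted Wilson–Dirac operator with antiperiodic quarks**: `bondWilsonDirac` of the
antiperiodic `U(N)` lift `apLift U` of an `SU(N)` field, `r = 1`, defining representation (the
crux's `wilsonDiracAP U m` is the case of all bonds). -/
def bondWilsonDiracAP (E : Finset (Edge 4 L)) (U : GaugeConfig 4 L (Matrix.specialUnitaryGroup (Fin N) ℂ))
    (m : ℝ) : Matrix (TorusSite 4 L × Fin N × Fin 4) (TorusSite 4 L × Fin N × Fin 4) ℂ :=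
  bondWilsonDirac (unitaryFundamentalRep (Fin N) ℂ) E (apLift U) m 1

/-- With every bond present the diluted antiperiodic operator is the crux's `wilsonDiracAP`. -/
theorem bondWilsonDiracAP_univ [NeZero L] (U : GaugeConfig 4 L (Matrix.specialUnitaryGroup (Fin N) ℂ)) (m : ℝ) :
    bondWilsonDiracAP univ U m = wilsonDiracAP U m := by
  rw [bondWilsonDiracAP, bondWilsonDirac_univ, wilsonDiracAP_def]

/-- The diluted antiperiodic determinant is real. -/
theorem det_bondWilsonDiracAP_im [NeZero L] (E : Finset (Edge 4 L))
    (U : GaugeConfig 4 L (Matrix.specialUnitaryGroup (Fin N) ℂ)) (m : ℝ) :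
    ((bondWilsonDiracAP E U m).det).im = 0 :=
  det_bondWilsonDirac_im _ unitaryFundamentalRep_mem_unitaryGroup E _ m 1

end AP

/-! ## Bond sets of the reflection-positivity peeling: slices, layers, closed slabs -/

section BondSets

variable {L : ℕ} [NeZero L]

/-- The spatial bonds inside the time slice `t` (time = coordinate `0`). -/
def sliceBonds (t : ZMod L) : Finset (Edge 4 L) :=
  univ.filter fun e => e.1 0 = t ∧ e.2 ≠ 0

/-- The temporal bonds leaving the time slice `t` (from `t` to `t + 1`). -/
def layerBonds (t : ZMod L) : Finset (Edge 4 L) :=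
  univ.filter fun e => e.1 0 = t ∧ e.2 = 0

/-- The bonds of the CLOSED time slab of the `ℓ + 1` slices `a, a+1, …, a+ℓ`: their spatial bonds
and the temporal bonds between consecutive ones (no bond leaves the slab; for `ℓ + 1 ≥ L` the
slab wraps and the description degenerates, the peeling only uses `ℓ ≤ L/2`). -/
def slabBonds (a : ZMod L) (ℓ : ℕ) : Finset (Edge 4 L) :=
  univ.filter fun e => (e.1 0 - a).val ≤ ℓ ∧ (e.2 ≠ 0 ∨ (e.1 0 - a).val < ℓ)

/-- Membership in `sliceBonds`. -/
@[simp] theorem mem_sliceBonds {t : ZMod L} {e : Edge 4 L} :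
    e ∈ sliceBonds t ↔ e.1 0 = t ∧ e.2 ≠ 0 := by
  simp [sliceBonds]

/-- Membership in `layerBonds`. -/
@[simp] theorem mem_layerBonds {t : ZMod L} {e : Edge 4 L} :
    e ∈ layerBonds t ↔ e.1 0 = t ∧ e.2 = 0 := by
  simp [layerBonds]

/-- Membership in `slabBonds`. -/
@[simp] theorem mem_slabBonds {a : ZMod L} {ℓ : ℕ} {e : Edge 4 L} :
    e ∈ slabBonds a ℓ ↔ (e.1 0 - a).val ≤ ℓ ∧ (e.2 ≠ 0 ∨ (e.1 0 - a).val < ℓ) := by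
  simp [slabBonds]

/-- A slab of one slice is that slice. -/
theorem slabBonds_zero (a : ZMod L) : slabBonds a 0 = sliceBonds a := by
  ext e
  simp only [mem_slabBonds, mem_sliceBonds, Nat.le_zero, Nat.not_lt_zero, or_false,
    ZMod.val_eq_zero, sub_eq_zero]

/-- Slices carry spatial bonds only: their directions lie in `univ.erase 0` (three directions). -/
theorem sliceBonds_dir {t : ZMod L} {e : Edge 4 L} (he : e ∈ sliceBonds t) :
    e.2 ∈ (univ : Finset (Fin 4)).erase 0 := by
  rw [mem_sliceBonds] at he
  simp [he.2]

/-- A union of slices carries spatial bonds only. -/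
theorem biUnion_sliceBonds_dir (T : Finset (ZMod L)) {e : Edge 4 L}
    (he : e ∈ T.biUnion sliceBonds) : e.2 ∈ (univ : Finset (Fin 4)).erase 0 := by
  obtain ⟨t, -, ht⟩ := Finset.mem_biUnion.1 he
  exact sliceBonds_dir ht

/-- The three spatial directions. -/
theorem card_univ_erase_zero : ((univ : Finset (Fin 4)).erase 0).card = 3 := by
  rw [Finset.card_erase_of_mem (Finset.mem_univ _), Finset.card_univ, Fintype.card_fin]

end BondSets

/-! ## The diluted operator with a general family of spin matrices

The link-reflection Gram identity of the line `Sketch` (stub `linkGram`) is computed in a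
`γ₀`-diagonal spin basis (`UnquenchedChessboardBoundLine.chiralGamma`); `bondWilsonDiracG` is the
diluted operator with the spin matrices as a parameter, so that a change of spin basis is a
conjugation (`det` unchanged) — the diluted analogue of `UnquenchedChessboardBoundLine.wilsonDiracG`. -/

section GeneralSpin

variable {L N : ℕ} {G : Type*} [Group G] (ρ : G →* Matrix (Fin N) (Fin N) ℂ)

/-- **The bond-diluted Wilson–Dirac matrix with an arbitrary family `γ` of `4 × 4` spin matrices**
(same formula as `bondWilsonDirac`, which is the case `γ = euclideanGamma`). -/
def bondWilsonDiracG (γ : Fin 4 → Matrix (Fin 4) (Fin 4) ℂ) (E : Finset (Edge 4 L))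
    (U : GaugeConfig 4 L G) (m r : ℝ) :
    Matrix (TorusSite 4 L × Fin N × Fin 4) (TorusSite 4 L × Fin N × Fin 4) ℂ :=
  Matrix.of fun p q =>
    (if p = q then ((m + 4 * r : ℝ) : ℂ) else 0) -
      (1 / 2 : ℂ) * ∑ μ : Fin 4,
        ((if q.1 = Site.shift p.1 μ ∧ (p.1, μ) ∈ E then
            ((r : ℂ) • (1 : Matrix (Fin 4) (Fin 4) ℂ) - γ μ) p.2.2 q.2.2 *
              ρ (U (p.1, μ)) p.2.1 q.2.1 else 0) +
          (if p.1 = Site.shift q.1 μ ∧ (q.1, μ) ∈ E then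
            ((r : ℂ) • (1 : Matrix (Fin 4) (Fin 4) ℂ) + γ μ) p.2.2 q.2.2 *
              ρ (U (q.1, μ))⁻¹ p.2.1 q.2.1 else 0))

/-- The diluted Wilson–Dirac matrix is `bondWilsonDiracG` with `γ = euclideanGamma`. -/
theorem bondWilsonDirac_eq_bondWilsonDiracG (E : Finset (Edge 4 L)) (U : GaugeConfig 4 L G)
    (m r : ℝ) : bondWilsonDirac ρ E U m r = bondWilsonDiracG ρ euclideanGamma E U m r := rfl

/-- The entry formula of `bondWilsonDiracG`. -/
theorem bondWilsonDiracG_apply (γ : Fin 4 → Matrix (Fin 4) (Fin 4) ℂ) (E : Finset (Edge 4 L))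
    (U : GaugeConfig 4 L G) (m r : ℝ) (p q : TorusSite 4 L × Fin N × Fin 4) :
    bondWilsonDiracG ρ γ E U m r p q =
      (if p = q then ((m + 4 * r : ℝ) : ℂ) else 0) -
        (1 / 2 : ℂ) * ∑ μ : Fin 4,
          ((if q.1 = Site.shift p.1 μ ∧ (p.1, μ) ∈ E then
              ((r : ℂ) • (1 : Matrix (Fin 4) (Fin 4) ℂ) - γ μ) p.2.2 q.2.2 *
                ρ (U (p.1, μ)) p.2.1 q.2.1 else 0) +
            (if p.1 = Site.shift q.1 μ ∧ (q.1, μ) ∈ E then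
              ((r : ℂ) • (1 : Matrix (Fin 4) (Fin 4) ℂ) + γ μ) p.2.2 q.2.2 *
                ρ (U (q.1, μ))⁻¹ p.2.1 q.2.1 else 0)) := rfl

/-- With every bond present `bondWilsonDiracG` has the formula of the undiluted operator: its
entries are those of `bondWilsonDiracG … univ`, i.e. membership conditions are vacuous. -/
theorem bondWilsonDiracG_univ_apply [NeZero L] (γ : Fin 4 → Matrix (Fin 4) (Fin 4) ℂ)
    (U : GaugeConfig 4 L G) (m r : ℝ) (p q : TorusSite 4 L × Fin N × Fin 4) :
    bondWilsonDiracG ρ γ univ U m r p q =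
      (if p = q then ((m + 4 * r : ℝ) : ℂ) else 0) -
        (1 / 2 : ℂ) * ∑ μ : Fin 4,
          ((if q.1 = Site.shift p.1 μ then
              ((r : ℂ) • (1 : Matrix (Fin 4) (Fin 4) ℂ) - γ μ) p.2.2 q.2.2 *
                ρ (U (p.1, μ)) p.2.1 q.2.1 else 0) +
            (if p.1 = Site.shift q.1 μ then
              ((r : ℂ) • (1 : Matrix (Fin 4) (Fin 4) ℂ) + γ μ) p.2.2 q.2.2 *
                ρ (U (q.1, μ))⁻¹ p.2.1 q.2.1 else 0)) := by
  simp only [bondWilsonDiracG, Matrix.of_apply, Finset.mem_univ, and_true]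

end GeneralSpin

end Summit.QuantumFields.QCD.Theorems.QuarksAsStableAction

end
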